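import Literature.MathematicalPhysics.KineticTheory.LambertianRedrawNondegenerate
import Literature.Analysis.FluidPDE.HardSphereScattering
import HarnessLib

/-!
# Λ-Liouville invariance, unit test `N = 1` (`LambertianContactSwap.LambertianEuler`,
# stmt-AtomisticToContinuum-11854, line `Sketch`; sub-goal `liouvilleInvarianceLambda_one` of the
# stub `stub_liouvilleInvariance`)

The Lambertian hard-sphere flow `Λ_t(z, ξs) = lambertFlow G ε ξs z t` of
`Literature.MathematicalPhysics.KineticTheory.LambertianHardSphereFlow` preserves the Liouville
measure in the annealed sense `((liouville G N ε) ⊗ lambertNoise).map Λ_t = liouville G N ε`.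
Here is the degenerate but honest first case `N = 1` on `𝕋³`: with one sphere there is no pair,
so the hard-sphere domain is the whole phase space (`hardSphereDomain_one`), the free flight never
leaves it (`freeExitTime_one`), the Lambertian flow is free flight whatever the noise
(`lambertFlow_one`), the Liouville measure is the volume (`liouville_one`), and the claim reduces
to `Measure.map_fst_prod` (the noise is a probability measure) and to the invariance of
Haar × Lebesgue measure under free flight on the torus
(`Alexander.measurePreserving_freeFlight_torusGeometry`). All [folklore].
-/

noncomputable section

open MeasureTheory ProbabilityTheory Set Literature.MathematicalPhysics.KineticTheory
  Literature.Analysis.FluidPDE Literature.Analysis.FluidPDE.Alexander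
open scoped ENNReal

namespace Summit.AtomisticToContinuum.HydrodynamicLimit.Theorems.LambertianContactSwapLambertianEulerLiouvilleOne

variable {d : Type*} [Fintype d] {X : Type*}

/-- With one sphere the hard-sphere domain is the whole phase space (the defining condition
`∀ i ≠ j, …` is vacuous on `Fin 1`). [folklore] -/
theorem hardSphereDomain_one (G : Geometry d X) (ε : ℝ) : hardSphereDomain G 1 ε = univ := by
  refine eq_univ_of_forall fun z => ?_
  rw [mem_hardSphereDomain]
  intro i j hij
  exact absurd (Subsingleton.elim i j) hij

/-- With one sphere the free flight never leaves the hard-sphere domain: `τ(z) = ∞`. [folklore] -/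
theorem freeExitTime_one (G : Geometry d X) (ε : ℝ) (z : Config 1 d X) :
    freeExitTime G ε z = ∞ := by
  rw [freeExitTime_eq_top_iff]
  intro t _
  rw [hardSphereDomain_one]
  exact mem_univ _

/-- With one sphere the Lambertian flow is free flight, whatever the noise. [folklore] -/
theorem lambertFlow_one (G : Geometry d X) (ε : ℝ) (ξs : ℕ → EuclideanSpace ℝ d)
    (z : Config 1 d X) (t : ℝ) : lambertFlow G ε ξs z t = freeFlight G t z :=
  lambertFlow_eq_freeFlight_of_lt (by rw [freeExitTime_one]; exact ENNReal.ofReal_lt_top)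

/-- With one sphere the Liouville measure is the volume of the phase space. [folklore] -/
theorem liouville_one [MeasureSpace X] (G : Geometry d X) (ε : ℝ) : liouville G 1 ε = volume := by
  rw [liouville_eq, hardSphereDomain_one, Measure.restrict_univ]

/-- **Λ-Liouville invariance for one sphere on `𝕋³`** (unit test `N = 1` of
`stub_liouvilleInvariance`): for `0 < ε < 1/2` and `t ≥ 0`,
`((liouville 1 ε) ⊗ lambertNoise).map (Λ_t) = liouville 1 ε`. With one sphere `Λ_t` is the free
flight of the first coordinate, the noise marginalises out (`Measure.map_fst_prod`), and free
flight preserves the volume of `(𝕋³ × ℝ³)^1`. [folklore] -/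
theorem liouvilleInvarianceLambda_one : ∀ ε : ℝ, 0 < ε → ε < 2⁻¹ → ∀ t : ℝ, 0 ≤ t →
    ((liouville (Torus.geometry (Fin 3)) 1 ε).prod (lambertNoise (Fin 3))).map
        (fun p => lambertFlow (Torus.geometry (Fin 3)) ε p.2 p.1 t) =
      liouville (Torus.geometry (Fin 3)) 1 ε := by
  intro ε _ _ t _
  have hfun : (fun p : Config 1 (Fin 3) (UnitAddTorus (Fin 3)) × (ℕ → EuclideanSpace ℝ (Fin 3)) =>
      lambertFlow (Torus.geometry (Fin 3)) ε p.2 p.1 t) =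
      freeFlight (Torus.geometry (Fin 3)) t ∘ Prod.fst :=
    funext fun p => lambertFlow_one _ _ _ _ _
  have hS := measurePreserving_freeFlight_torusGeometry (N := 1) (d := Fin 3) t
  rw [hfun, ← Measure.map_map hS.measurable measurable_fst, Measure.map_fst_prod, measure_univ,
    one_smul, liouville_one, hS.map_eq]

end Summit.AtomisticToContinuum.HydrodynamicLimit.Theorems.LambertianContactSwapLambertianEulerLiouvilleOne

end
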